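import Mathlib
import HarnessLib

/-!
# Approximate identities: `∫ φ • F dμ → F(x₀)` as the bump `φ` concentrates at `x₀`

Topic `MeasureTheory/Integral`; namespace `Literature.MeasureTheory.Integral.BumpApprox`. The pointwise
approximate-identity estimate on a locally compact Hausdorff SPACE `X` with a measure finite on compacts
and positive on opens, one bump at a time (no sequence, no countability, no group structure):

* `norm_integral_smul_sub_le` — if `φ ≥ 0` has total mass `1` and `‖F x − F x₀‖ ≤ ε` on the support of
  `φ`, then `‖∫ φ • F dμ − F x₀‖ ≤ ε`;
* `exists_bump_subset` — Urysohn bumps: `φ ∈ C_c(X, [0, ∞))`, `φ x₀ = 1`, `supp φ ⊆ U`;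
* `exists_normalised_bump` — in every open `U ∋ x₀` a continuous compactly supported `φ ≥ 0` with
  `∫ φ dμ = 1`;
* `exists_bump_norm_integral_smul_sub_lt` — for continuous `F : X → E` (real Banach `E`), `ε > 0` and
  open `U ∋ x₀` a normalised bump `φ` supported in `U` with `‖∫ φ • F dμ − F x₀‖ < ε`;
* `bumpCc` (the complex test function of a real bump) and `mem_closure_range_integral_smul` — hence
  `F x₀ ∈ closure {∫ f • F dμ : f ∈ C_c(X, ℂ)}` for `F` continuous into a complex Banach space.

This is the "Dirac function" mechanism of Deitmar–Echterhoff §1.6 (Dirac functions and families,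
Lemma 1.6.6: `φ_U * f → f` compactly uniformly for continuous `f`) in its pointwise, group-free form;
on a group with Haar measure and `F = (h ↦ π(h) v)` it is the usual approximate-identity limit. Mathlib's
`MeasureTheory.Integral.PeakFunction` (`tendsto_setIntegral_peak_smul_of_integrableOn_of_tendsto`, …)
is the FILTER version for a given peaking family; this file supplies the bumps and the one-shot `ε`-form.

Provenance: HodgeCM PerL cell `pub-hodgecm`, package file `HodgeCM/Automorphic/BumpApprox.lean` (seat
pv15-g2, gate run 23; there the consumer is the toric-period map `h ↦ ϑ_{T,χ}(ω(h)Φ)` of [PerL] v5 Thm 3.7),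
ported to the tree under the LEAN-IN-TREE rule by seat pv15-g6 with the Urysohn bump of
`HodgeCM.PerL34.Vanishing.exists_bump_subset` inlined (names `HodgeCM.BumpApprox.X` ↦
`Literature.MeasureTheory.Integral.BumpApprox.X`, statements verbatim).

## References

* A. Deitmar, S. Echterhoff, *Principles of Harmonic Analysis*, 2nd ed. (2014), §1.6 (Dirac functions),
  Lemma 1.6.6 [DeitmarEchterhoff2014].
-/

noncomputable section

open Set Filter
open _root_.MeasureTheory _root_.Topology
open scoped CompactlySupported

namespace Literature.MeasureTheory.Integral

namespace BumpApprox

section Estimate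

variable {X : Type*} [MeasurableSpace X] (μ : Measure X)
variable {E : Type*} [NormedAddCommGroup E] [NormedSpace ℝ E] [CompleteSpace E]

/-- **The approximate-identity estimate.** If `φ ≥ 0` has total mass one and `F` is within `ε` of
`F x₀` on the support of `φ`, then `∫ φ • F dμ` is within `ε` of `F x₀`. [folklore] -/
theorem norm_integral_smul_sub_le {φ : X → ℝ} {F : X → E} {x₀ : X} {ε : ℝ}
    (hφi : Integrable φ μ) (hφF : Integrable (fun x => φ x • F x) μ) (hφ0 : ∀ x, 0 ≤ φ x)
    (hφ1 : ∫ x, φ x ∂μ = 1) (hε : ∀ x ∈ Function.support φ, ‖F x - F x₀‖ ≤ ε) :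
    ‖∫ x, φ x • F x ∂μ - F x₀‖ ≤ ε := by
  have h1 : ∫ x, φ x • F x ∂μ - F x₀ = ∫ x, φ x • (F x - F x₀) ∂μ := by
    simp_rw [smul_sub]
    rw [integral_sub hφF (hφi.smul_const _), integral_smul_const, hφ1, one_smul]
  rw [h1]
  calc ‖∫ x, φ x • (F x - F x₀) ∂μ‖ ≤ ∫ x, φ x * ε ∂μ := by
        refine norm_integral_le_of_norm_le (hφi.mul_const ε) (Eventually.of_forall fun x => ?_)
        rw [norm_smul, Real.norm_of_nonneg (hφ0 x)]
        by_cases hx : φ x = 0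
        · simp [hx]
        · exact mul_le_mul_of_nonneg_left (hε x hx) (hφ0 x)
    _ = ε := by rw [integral_mul_const, hφ1, one_mul]

end Estimate

section Bump

variable {X : Type*} [TopologicalSpace X] [LocallyCompactSpace X] [T2Space X]

/-- **Urysohn bumps**: in every open neighbourhood `U` of `x₀` there is a continuous compactly supported
`φ ≥ 0` with `φ x₀ = 1` and `supp φ ⊆ U` (Urysohn's lemma for the compact `{x₀}` inside the open
`interior K ∩ U`, `K` a compact neighbourhood). [folklore] -/
theorem exists_bump_subset (x₀ : X) {U : Set X} (hU : IsOpen U) (hxU : x₀ ∈ U) :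
    ∃ φ : X → ℝ, Continuous φ ∧ HasCompactSupport φ ∧ (∀ x, 0 ≤ φ x) ∧ φ x₀ = 1 ∧
      Function.support φ ⊆ U := by
  obtain ⟨K, hK, hKx⟩ := exists_compact_mem_nhds x₀
  have hx₀ : x₀ ∈ interior K ∩ U := ⟨mem_interior_iff_mem_nhds.mpr hKx, hxU⟩
  have hso : IsOpen (interior K ∩ U) := isOpen_interior.inter hU
  have hcl : IsCompact (closure (interior K ∩ U)) :=
    hK.of_isClosed_subset isClosed_closure
      (closure_minimal (inter_subset_left.trans interior_subset) hK.isClosed)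
  obtain ⟨φ, hφs, hφ1, hφ01⟩ := exists_tsupport_one_of_isOpen_isClosed hso hcl
    isClosed_singleton (singleton_subset_iff.mpr hx₀)
  refine ⟨φ, φ.continuous, ?_, fun x => (hφ01 x).1, ?_, ?_⟩
  · exact HasCompactSupport.intro hK fun x hx =>
      image_eq_zero_of_notMem_tsupport fun h' => hx (interior_subset (hφs h').1)
  · have h1 := hφ1 (mem_singleton x₀)
    simpa using h1
  · exact (subset_tsupport _).trans (hφs.trans inter_subset_right)

variable [MeasurableSpace X] [OpensMeasurableSpace X] (μ : Measure X) [IsFiniteMeasureOnCompacts μ]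
  [μ.IsOpenPosMeasure]
variable {E : Type*} [NormedAddCommGroup E] [NormedSpace ℝ E] [CompleteSpace E]

/-- **Normalised bumps exist**: in every open neighbourhood `U` of `x₀` there is a continuous compactly
supported `φ ≥ 0` with `∫ φ dμ = 1` (the measure is positive on opens and finite on compacts).
[folklore] -/
theorem exists_normalised_bump (x₀ : X) {U : Set X} (hU : IsOpen U) (hxU : x₀ ∈ U) :
    ∃ φ : X → ℝ, Continuous φ ∧ HasCompactSupport φ ∧ (∀ x, 0 ≤ φ x) ∧ ∫ x, φ x ∂μ = 1 ∧
      Function.support φ ⊆ U := by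
  obtain ⟨ψ, hψc, hψs, hψ0, hψ1, hψU⟩ := exists_bump_subset x₀ hU hxU
  have hpos : 0 < ∫ x, ψ x ∂μ :=
    hψc.integral_pos_of_hasCompactSupport_nonneg_nonzero hψs (fun x => hψ0 x)
      (by rw [hψ1]; exact one_ne_zero)
  set c := ∫ x, ψ x ∂μ with hc
  refine ⟨fun x => ψ x / c, hψc.div_const c, ?_, fun x => div_nonneg (hψ0 x) hpos.le, ?_, ?_⟩
  · refine hψs.mono fun x hx => ?_
    have hx' : ψ x / c ≠ 0 := hx
    intro h
    exact hx' (by simp [h])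
  · rw [integral_div, div_self hpos.ne']
  · intro x hx
    refine hψU ?_
    simp only [Function.mem_support, ne_eq] at hx ⊢
    intro h
    exact hx (by simp [h])

/-- **The approximate-identity limit, `ε`-form.** For `F` continuous, `x₀ ∈ U` open and `ε > 0` there is
a normalised bump `φ` supported in `U` with `‖∫ φ • F dμ − F x₀‖ < ε` (Deitmar–Echterhoff §1.6: Dirac
functions; pointwise form). [cite: DeitmarEchterhoff2014, Lemma 1.6.6] -/
theorem exists_bump_norm_integral_smul_sub_lt {F : X → E} (hF : Continuous F) (x₀ : X)
    {U : Set X} (hU : IsOpen U) (hxU : x₀ ∈ U) {ε : ℝ} (hε : 0 < ε) :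
    ∃ φ : X → ℝ, Continuous φ ∧ HasCompactSupport φ ∧ (∀ x, 0 ≤ φ x) ∧ ∫ x, φ x ∂μ = 1 ∧
      Function.support φ ⊆ U ∧ ‖∫ x, φ x • F x ∂μ - F x₀‖ < ε := by
  set V : Set X := U ∩ F ⁻¹' Metric.ball (F x₀) (ε / 2) with hV
  have hVo : IsOpen V := hU.inter (Metric.isOpen_ball.preimage hF)
  have hxV : x₀ ∈ V := ⟨hxU, by simp [hε]⟩
  obtain ⟨φ, hφc, hφs, hφ0, hφ1, hφV⟩ := exists_normalised_bump μ x₀ hVo hxV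
  refine ⟨φ, hφc, hφs, hφ0, hφ1, hφV.trans inter_subset_left, ?_⟩
  have hφi : Integrable φ μ := hφc.integrable_of_hasCompactSupport hφs
  have hφF : Integrable (fun x => φ x • F x) μ :=
    (hφc.smul hF).integrable_of_hasCompactSupport (hφs.smul_right (f' := F))
  have hle : ‖∫ x, φ x • F x ∂μ - F x₀‖ ≤ ε / 2 := by
    refine norm_integral_smul_sub_le μ hφi hφF hφ0 hφ1 fun x hx => ?_
    have hx' := (hφV hx).2
    rw [mem_preimage, Metric.mem_ball, dist_eq_norm] at hx'
    exact hx'.le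
  linarith

end Bump

section BumpCc

variable {X : Type*} [TopologicalSpace X]

/-- The complex test function `x ↦ (φ x : ℂ) ∈ C_c(X, ℂ)` attached to a real bump `φ`. [folklore] -/
def bumpCc {φ : X → ℝ} (hφc : Continuous φ) (hφs : HasCompactSupport φ) : C_c(X, ℂ) where
  toFun x := (φ x : ℂ)
  continuous_toFun := Complex.continuous_ofReal.comp hφc
  hasCompactSupport' := hφs.comp_left Complex.ofReal_zero

/-- Unfolding of `bumpCc`. [folklore] -/
@[simp] theorem bumpCc_apply {φ : X → ℝ} (hφc : Continuous φ) (hφs : HasCompactSupport φ) (x : X) :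
    bumpCc hφc hφs x = (φ x : ℂ) := rfl

end BumpCc

section Complex

variable {X : Type*} [TopologicalSpace X] [LocallyCompactSpace X] [T2Space X] [MeasurableSpace X]
  [OpensMeasurableSpace X] (μ : Measure X) [IsFiniteMeasureOnCompacts μ] [μ.IsOpenPosMeasure]
variable {E : Type*} [NormedAddCommGroup E] [NormedSpace ℂ E] [CompleteSpace E]

/-- **The approximate-identity limit, closure form**: for `F : X → E` continuous into a complex Banach
space, `F x₀` lies in the closure of `{∫ f • F dμ : f ∈ C_c(X, ℂ)}`.
[cite: DeitmarEchterhoff2014, Lemma 1.6.6] -/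
theorem mem_closure_range_integral_smul {F : X → E} (hF : Continuous F) (x₀ : X) :
    F x₀ ∈ closure (Set.range fun f : C_c(X, ℂ) => ∫ x, (f x : ℂ) • F x ∂μ) := by
  rw [Metric.mem_closure_iff]
  intro ε hε
  obtain ⟨φ, hφc, hφs, hφ0, hφ1, -, hlt⟩ :=
    exists_bump_norm_integral_smul_sub_lt μ hF x₀ isOpen_univ (mem_univ x₀) hε
  refine ⟨_, ⟨bumpCc hφc hφs, rfl⟩, ?_⟩
  have h : (∫ x, (bumpCc hφc hφs x : ℂ) • F x ∂μ) = ∫ x, φ x • F x ∂μ := by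
    simp only [bumpCc_apply, Complex.coe_smul]
  rw [dist_comm, dist_eq_norm]
  show ‖(∫ x, (bumpCc hφc hφs x : ℂ) • F x ∂μ) - F x₀‖ < ε
  rw [h]
  exact hlt

end Complex

end BumpApprox

end Literature.MeasureTheory.Integral

end
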